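import Summits.Ventures.LatticeQCDFlow.Scaling.PersistentPairConstants

/-!
HONEST FRAMING: exact (Metropolis-corrected) sampling algorithms for lattice gauge theory; figures
of merit are autocorrelation/cost numbers at stated couplings and volumes; no continuum-physics
claim.

# PersistentPairEigenfunction — THE EXPLICIT APPROXIMATE EIGENFUNCTION OF THE (COLD `u`-COUNT, HUB INDICATOR) PAIR WITH PERSISTENCE:
# `Φ(G,1) = f(G) + κ(G)`, `Φ(G,0) = f(G)`, `f(G) = (G − g⋆K)·e^{γ(G − g⋆K)/K}`, `κ(G) = c·A(G/K)·e^{γ(G − g⋆K)/K}`, WHOSE ONE-STEP DEFECT AGAINST THE RATE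
# `1 − Λ/K`, `Λ = σ(1−σ)c̄/((1−σ) + σαβ/c̄)`, IS `≤ 4c(1+c)e^c/K` UNIFORMLY IN `G ∈ [0,K]` (lean-2 GEN-46, ours)

Venture-side (OURS).  Cell `lqcd-flow` (pub-lqcd), unit `pub-lqcd-lean-2-g46`, 2026-08-31.  Chapter AF (the law-free `½·log K` with persistence), file 3b — pure real analysis on the
constants of file 3a (`c̄`, `g⋆`, `D₀`, `Λ`, `γ`, `c`, `A(g) = α(1−g) + βg`).  From state `(G, hub = u)` the pair chain of file 2 moves to `(G+1, hub ≠ u)` w.p. `σα(K−G)/K` and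
to `(G, hub ≠ u)` w.p. `(1−σ)(1−p)`; from `(G, hub ≠ u)` to `(G−1, hub = u)` w.p. `σβG/K` and to `(G, hub = u)` w.p. `(1−σ)p` (all other moves keep the pair).  For `Φ` as in the
title the one-step defects against the factor `1 − Λ/K` are
`E₁(G) = σα((K−G)/K)(f(G+1) − f(G) − κ(G)) − (1−σ)(1−p)κ(G) + (Λ/K)(f(G) + κ(G))` and `E₀(G) = σβ(G/K)(f(G−1) + κ(G−1) − f(G)) + (1−σ)pκ(G) + (Λ/K)f(G)`;
with `y = G − g⋆K`, `E = e^{γy/K}`: `f(G) = yE`, `f(G±1) = (y±1)E·e^{±γ/K}`, `κ(G) = cAE`, and `E₁ = E·[MAIN₁(G/K) + REM₁]`, `E₀ = E·[MAIN₀(G/K) + REM₀]` by `ring`, where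
`MAIN₁ = MAIN₀ = 0` are file 3a's identities and the remainders collect the Taylor errors of `e^{±γ/K}` (`|γ| ≤ c ≤ K`).  Hypothesis-equations, no definitions.

* §1 **`pairEigen_defect_one`**, **`pairEigen_defect_zero`** (`|E₁(G)|, |E₀(G)| ≤ 4c(1+c)e^c/K` for `G ≤ K`, given `c ≤ K`); §2 the jumps `pairEigen_f_succ_sub`, `pairEigen_f_pred_sub`
  (`≤ 2(1+c)²e^c`), `pairEigen_κ_bounds` (`0 ≤ κ ≤ ce^c`); §3 the two starts `pairEigen_start_crowded` (`f(K) + κ(K) ≥ K(1−g⋆)e^{−c}`), `pairEigen_start_free` (`−f(0) ≥ Kg⋆e^{−c}`).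

Reading (no numerics implied): the toy `numerics46/eigen_defect.py` (pure python, nothing claimed) shows `K·sup_G max{|E₁|,|E₀|} = 0.25 ∕ 0.06 ∕ 1.17` constant in `K = 50…800` at
`(σ, W_u/W_v) = (½,4) ∕ (¼,16) ∕ (¾,4)` against the typed `4c(1+c)e^c = 8e ∕ 1.6 ∕ 380` — the order `1/K` is the point, the constant is not optimised.  Literature grade (cell rule):
OWN, elementary (two-time-scale averaging made exact at first order); nothing cited; no new bib keys.
-/

noncomputable section

namespace Summit.Ventures.LatticeQCDFlow.Scaling

section PairEigenDefect
variable {K : ℕ} {σ α β p cbar gs D0 Λ γ c : ℝ} {f κ : ℕ → ℝ}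

/-! ## §1 The defects -/

/-- **THE DEFECT AT HUB `= u`:** for `G ≤ K` (`K ≥ 1`, `c ≤ K`),
**`|σα((K−G)/K)(f(G+1) − f(G) − κ(G)) − (1−σ)(1−p)κ(G) + (Λ/K)(f(G) + κ(G))| ≤ 4c(1+c)e^c/K`**. [ours] -/
theorem pairEigen_defect_one (hσ0 : 0 < σ) (hσ1 : σ < 1) (hα0 : 0 < α) (hα1 : α ≤ 1) (hβ0 : 0 < β) (hβ1 : β ≤ 1) (hp0 : 0 < p) (hp1 : p < 1)
    (hcbar : cbar = p * α + (1 - p) * β) (hgs : gs = p * α / cbar) (hD0 : D0 = (1 - σ) + σ * α * β / cbar) (hΛ : Λ = σ * (1 - σ) * cbar / D0)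
    (hγ : γ = σ * (β - α) / D0) (hc : c = σ / D0)
    (hf : ∀ G : ℕ, f G = ((G : ℝ) - gs * K) * Real.exp (γ * (((G : ℝ) - gs * K) / K)))
    (hκ : ∀ G : ℕ, κ G = c * ((α * ((K : ℝ) - G) + β * G) / K) * Real.exp (γ * (((G : ℝ) - gs * K) / K)))
    (hK : 1 ≤ K) (hcK : c ≤ K) {G : ℕ} (hG : G ≤ K) :
    |σ * α * (((K : ℝ) - G) / K) * (f (G + 1) - f G - κ G) - (1 - σ) * (1 - p) * κ G + Λ / K * (f G + κ G)| ≤ 4 * c * (1 + c) * Real.exp c / K := by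
  have hK0 : (0 : ℝ) < K := by exact_mod_cast (show 0 < K by omega)
  have hK1 : (1 : ℝ) ≤ K := by exact_mod_cast hK
  have hGK : (G : ℝ) ≤ K := by exact_mod_cast hG
  have hG0 : (0 : ℝ) ≤ G := Nat.cast_nonneg G
  have hgsb := pairEigen_gs_bounds hα0 hα1 hβ0 hβ1 hp0 hp1 hcbar hgs
  have hcc := pairEigen_c_bounds hσ0 hσ1 hα0 hα1 hβ0 hβ1 hp0 hp1 hcbar hD0 hc
  have hΛb := pairEigen_Λ_bounds hσ0 hσ1 hα0 hα1 hβ0 hβ1 hp0 hp1 hcbar hD0 hΛ hc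
  have hγc := pairEigen_abs_γ_le_c hσ0 hσ1 hα0 hα1 hβ0 hβ1 hp0 hp1 hcbar hD0 hγ hc
  have hA := pairEigen_A_bounds hα0 hα1 hβ0 hβ1 hK hG
  have hW := pairEigen_weight_bounds hK hG hgsb.1.le hgsb.2.le hγc
  -- elementary sizes (before naming the atoms)
  have hgsK : gs * K ≤ (K : ℝ) := mul_le_of_le_one_left hK0.le hgsb.2.le
  have hgsK0 : 0 ≤ gs * (K : ℝ) := mul_nonneg hgsb.1.le hK0.le
  have hy1 : |(G : ℝ) - gs * K + 1| ≤ K + 1 := abs_le.mpr ⟨by linarith, by linarith⟩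
  have hfrac0 : 0 ≤ ((K : ℝ) - G) / K := div_nonneg (by linarith) hK0.le
  have hfrac1 : ((K : ℝ) - G) / K ≤ 1 := by rw [div_le_one hK0]; linarith
  have hσα : σ * α ≤ 1 := mul_le_one₀ hσ1.le hα0.le hα1
  have hs0 : 0 ≤ σ * α * (((K : ℝ) - G) / K) := mul_nonneg (mul_nonneg hσ0.le hα0.le) hfrac0
  have hs1 : σ * α * (((K : ℝ) - G) / K) ≤ 1 := mul_le_one₀ hσα hfrac0 hfrac1
  have hL0 : 0 ≤ Λ * c * ((α * ((K : ℝ) - G) + β * G) / K) := mul_nonneg (mul_nonneg hΛb.1.le hcc.1.le) hA.1.le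
  have hL : Λ * c * ((α * ((K : ℝ) - G) + β * G) / K) ≤ c ^ 2 := by
    have h1 : Λ * c ≤ c * c := mul_le_mul_of_nonneg_right hΛb.2.1 hcc.1.le
    have h2 : Λ * c * ((α * ((K : ℝ) - G) + β * G) / K) ≤ Λ * c * 1 := mul_le_mul_of_nonneg_left hA.2 (mul_nonneg hΛb.1.le hcc.1.le)
    nlinarith [h1, h2]
  have hfin : (c + 3 * c ^ 2) / (K : ℝ) ≤ 4 * c * (1 + c) / K := by
    apply div_le_div_of_nonneg_right _ hK0.le
    nlinarith [hcc.1, sq_nonneg c]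
  -- the atoms
  set y : ℝ := (G : ℝ) - gs * K with hy
  set E : ℝ := Real.exp (γ * (y / K)) with hE
  set A : ℝ := (α * ((K : ℝ) - G) + β * G) / K with hAdef
  set ep : ℝ := Real.exp (γ / K) with hep
  have hE0 : 0 < E := Real.exp_pos _
  have hsK : |γ / K| ≤ 1 := by
    rw [abs_div, abs_of_pos hK0, div_le_one hK0]
    exact le_trans hγc hcK
  obtain ⟨hr, -, -⟩ := pairEigen_exp_small hsK
  -- the three values
  have e2 : f G = y * E := by rw [hf]
  have e3 : κ G = c * A * E := by rw [hκ]
  have e1 : f (G + 1) = (y + 1) * E * ep := by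
    rw [hf]
    have h1 : (((G + 1 : ℕ) : ℝ) - gs * K) = y + 1 := by push_cast; rw [hy]; ring
    have h2 : γ * ((((G + 1 : ℕ) : ℝ) - gs * K) / K) = γ * (y / K) + γ / K := by rw [h1]; ring
    rw [h2, h1, Real.exp_add]; ring
  -- file 3a's identity at `g = G/K`
  have hmain := pairEigen_identity_one hσ0 hσ1 hα0 hβ0 hp0 hp1 hcbar hgs hD0 hΛ hγ hc ((G : ℝ) / K)
  have hg3 : α * (1 - (G : ℝ) / K) + β * ((G : ℝ) / K) = A := by rw [hAdef]; field_simp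
  have hg1 : 1 - (G : ℝ) / K = ((K : ℝ) - G) / K := by field_simp
  have hg2 : (G : ℝ) / K - gs = y / K := by rw [hy]; field_simp
  rw [hg3, hg1, hg2] at hmain
  -- defect `= E·(MAIN + REM)`, `MAIN = 0`
  have key : σ * α * (((K : ℝ) - G) / K) * (f (G + 1) - f G - κ G) - (1 - σ) * (1 - p) * κ G + Λ / K * (f G + κ G)
      = E * (σ * α * (((K : ℝ) - G) / K) * (γ / K + (y + 1) * (ep - 1 - γ / K)) + Λ * c * A / K) := by
    have h : σ * α * (((K : ℝ) - G) / K) * (f (G + 1) - f G - κ G) - (1 - σ) * (1 - p) * κ G + Λ / K * (f G + κ G)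
        = E * (σ * α * (((K : ℝ) - G) / K) * (1 + γ * (y / K) - c * A) - (1 - σ) * (1 - p) * (c * A) + Λ * (y / K))
          + E * (σ * α * (((K : ℝ) - G) / K) * (γ / K + (y + 1) * (ep - 1 - γ / K)) + Λ * c * A / K) := by
      rw [e1, e2, e3]; ring
    rw [h, hmain, mul_zero, zero_add]
  rw [key, abs_mul, abs_of_pos hE0]
  -- the remainder, with the exponentials as free reals (file 3a)
  have hrem := pairEigen_rem_one hK1 hs0 hs1 hγc hy1 hr hL0 hL
  calc E * |σ * α * (((K : ℝ) - G) / K) * (γ / K + (y + 1) * (ep - 1 - γ / K)) + Λ * c * A / K|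
      ≤ Real.exp c * (4 * c * (1 + c) / K) := mul_le_mul hW.2.1 (le_trans hrem hfin) (abs_nonneg _) (Real.exp_pos c).le
    _ = 4 * c * (1 + c) * Real.exp c / K := by ring

/-- **THE DEFECT AT HUB `≠ u`:** for `G ≤ K` (`K ≥ 1`, `c ≤ K`),
**`|σβ(G/K)(f(G−1) + κ(G−1) − f(G)) + (1−σ)pκ(G) + (Λ/K)f(G)| ≤ 4c(1+c)e^c/K`** (`ℕ`-subtraction; at `G = 0` the first term has coefficient `0`). [ours] -/
theorem pairEigen_defect_zero (hσ0 : 0 < σ) (hσ1 : σ < 1) (hα0 : 0 < α) (hα1 : α ≤ 1) (hβ0 : 0 < β) (hβ1 : β ≤ 1) (hp0 : 0 < p) (hp1 : p < 1)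
    (hcbar : cbar = p * α + (1 - p) * β) (hgs : gs = p * α / cbar) (hD0 : D0 = (1 - σ) + σ * α * β / cbar) (hΛ : Λ = σ * (1 - σ) * cbar / D0)
    (hγ : γ = σ * (β - α) / D0) (hc : c = σ / D0)
    (hf : ∀ G : ℕ, f G = ((G : ℝ) - gs * K) * Real.exp (γ * (((G : ℝ) - gs * K) / K)))
    (hκ : ∀ G : ℕ, κ G = c * ((α * ((K : ℝ) - G) + β * G) / K) * Real.exp (γ * (((G : ℝ) - gs * K) / K)))
    (hK : 1 ≤ K) (hcK : c ≤ K) {G : ℕ} (hG : G ≤ K) :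
    |σ * β * ((G : ℝ) / K) * (f (G - 1) + κ (G - 1) - f G) + (1 - σ) * p * κ G + Λ / K * f G| ≤ 4 * c * (1 + c) * Real.exp c / K := by
  have hK0 : (0 : ℝ) < K := by exact_mod_cast (show 0 < K by omega)
  have hK1 : (1 : ℝ) ≤ K := by exact_mod_cast hK
  have hGK : (G : ℝ) ≤ K := by exact_mod_cast hG
  have hG0 : (0 : ℝ) ≤ G := Nat.cast_nonneg G
  have hgsb := pairEigen_gs_bounds hα0 hα1 hβ0 hβ1 hp0 hp1 hcbar hgs
  have hcc := pairEigen_c_bounds hσ0 hσ1 hα0 hα1 hβ0 hβ1 hp0 hp1 hcbar hD0 hc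
  have hΛb := pairEigen_Λ_bounds hσ0 hσ1 hα0 hα1 hβ0 hβ1 hp0 hp1 hcbar hD0 hΛ hc
  have hγc := pairEigen_abs_γ_le_c hσ0 hσ1 hα0 hα1 hβ0 hβ1 hp0 hp1 hcbar hD0 hγ hc
  have hA := pairEigen_A_bounds hα0 hα1 hβ0 hβ1 hK hG
  have hW := pairEigen_weight_bounds hK hG hgsb.1.le hgsb.2.le hγc
  -- elementary sizes (before naming the atoms)
  have hgsK : gs * K ≤ (K : ℝ) := mul_le_of_le_one_left hK0.le hgsb.2.le
  have hgsK0 : 0 ≤ gs * (K : ℝ) := mul_nonneg hgsb.1.le hK0.le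
  have hy1 : |(G : ℝ) - gs * K - 1| ≤ K + 1 := abs_le.mpr ⟨by linarith, by linarith⟩
  have hfrac0 : 0 ≤ (G : ℝ) / K := div_nonneg hG0 hK0.le
  have hfrac1 : (G : ℝ) / K ≤ 1 := by rw [div_le_one hK0]; exact hGK
  have hσβ : σ * β ≤ 1 := mul_le_one₀ hσ1.le hβ0.le hβ1
  have hs0 : 0 ≤ σ * β * ((G : ℝ) / K) := mul_nonneg (mul_nonneg hσ0.le hβ0.le) hfrac0
  have hs1 : σ * β * ((G : ℝ) / K) ≤ 1 := mul_le_one₀ hσβ hfrac0 hfrac1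
  have hL0 : 0 ≤ c * ((α * ((K : ℝ) - G) + β * G) / K) := mul_nonneg hcc.1.le hA.1.le
  have hL : c * ((α * ((K : ℝ) - G) + β * G) / K) ≤ c := by
    have := mul_le_mul_of_nonneg_left hA.2 hcc.1.le
    linarith
  have hb : |β - α| ≤ 1 := abs_le.mpr ⟨by linarith, by linarith⟩
  have hfin : (4 * c + 4 * c ^ 2) / (K : ℝ) = 4 * c * (1 + c) / K := by ring
  have hpos : 0 ≤ 4 * c * (1 + c) * Real.exp c / K := by
    have := hcc.1
    positivity
  set y : ℝ := (G : ℝ) - gs * K with hy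
  set E : ℝ := Real.exp (γ * (y / K)) with hE
  set A : ℝ := (α * ((K : ℝ) - G) + β * G) / K with hAdef
  have hE0 : 0 < E := Real.exp_pos _
  have e2 : f G = y * E := by rw [hf]
  have e3 : κ G = c * A * E := by rw [hκ]
  have hmain := pairEigen_identity_zero hσ0 hσ1 hα0 hβ0 hp0 hp1 hcbar hgs hD0 hΛ hγ hc ((G : ℝ) / K)
  have hg3 : α * (1 - (G : ℝ) / K) + β * ((G : ℝ) / K) = A := by rw [hAdef]; field_simp
  have hg2 : (G : ℝ) / K - gs = y / K := by rw [hy]; field_simp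
  rw [hg3, hg2] at hmain
  rcases Nat.eq_zero_or_pos G with hG0eq | hGpos
  · -- `G = 0`: the swap term has coefficient `0`, the rest is `E·MAIN₀(0) = 0`
    subst hG0eq
    have h0 : σ * β * (((0 : ℕ) : ℝ) / K) = 0 := by simp
    rw [h0] at hmain ⊢
    have key : 0 * (f (0 - 1) + κ (0 - 1) - f 0) + (1 - σ) * p * κ 0 + Λ / K * f 0
        = E * (0 * (-1 - γ * (y / K) + c * A) + (1 - σ) * p * (c * A) + Λ * (y / K)) := by
      rw [e2, e3]; ring
    rw [key, hmain, mul_zero, abs_zero]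
    exact hpos
  -- `G ≥ 1`
  set em : ℝ := Real.exp (-(γ / K)) with hem
  have hsK : |-(γ / K)| ≤ 1 := by
    rw [abs_neg, abs_div, abs_of_pos hK0, div_le_one hK0]
    exact le_trans hγc hcK
  obtain ⟨hr, hr1, hr3⟩ := pairEigen_exp_small hsK
  have hG1 : ((G - 1 : ℕ) : ℝ) = (G : ℝ) - 1 := by rw [Nat.cast_sub (by omega)]; simp
  have e1 : f (G - 1) = (y - 1) * E * em := by
    rw [hf, hG1]
    have h1 : ((G : ℝ) - 1 - gs * K) = y - 1 := by rw [hy]; ring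
    have h2 : γ * (((G : ℝ) - 1 - gs * K) / K) = γ * (y / K) + -(γ / K) := by rw [h1]; ring
    rw [h2, h1, Real.exp_add]; ring
  have e4 : κ (G - 1) = c * (A - (β - α) / K) * E * em := by
    rw [hκ, hG1]
    have h1 : ((G : ℝ) - 1 - gs * K) = y - 1 := by rw [hy]; ring
    have h2 : γ * (((G : ℝ) - 1 - gs * K) / K) = γ * (y / K) + -(γ / K) := by rw [h1]; ring
    have h3 : (α * ((K : ℝ) - ((G : ℝ) - 1)) + β * ((G : ℝ) - 1)) / K = A - (β - α) / K := by rw [hAdef]; ring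
    rw [h2, h3, Real.exp_add]; ring
  have key : σ * β * ((G : ℝ) / K) * (f (G - 1) + κ (G - 1) - f G) + (1 - σ) * p * κ G + Λ / K * f G
      = E * (σ * β * ((G : ℝ) / K) * (γ / K + (y - 1) * (em - 1 - -(γ / K)) + c * A * (em - 1) - c * ((β - α) / K) * em)) := by
    have h : σ * β * ((G : ℝ) / K) * (f (G - 1) + κ (G - 1) - f G) + (1 - σ) * p * κ G + Λ / K * f G
        = E * (σ * β * ((G : ℝ) / K) * (-1 - γ * (y / K) + c * A) + (1 - σ) * p * (c * A) + Λ * (y / K))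
          + E * (σ * β * ((G : ℝ) / K) * (γ / K + (y - 1) * (em - 1 - -(γ / K)) + c * A * (em - 1) - c * ((β - α) / K) * em)) := by
      rw [e1, e2, e3, e4]; ring
    rw [h, hmain, mul_zero, zero_add]
  rw [key, abs_mul, abs_of_pos hE0]
  have hr' : |em - 1 - -(γ / K)| ≤ (γ / K) ^ 2 := by rw [← neg_sq]; exact hr
  have hd : |em - 1| ≤ 2 * |γ / K| := by rw [← abs_neg (γ / K)]; exact hr1
  have hrem := pairEigen_rem_zero hK1 hs0 hs1 hγc hy1 hr' hd (Real.exp_pos _).le hr3 hL0 hL hb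
  calc E * |σ * β * ((G : ℝ) / K) * (γ / K + (y - 1) * (em - 1 - -(γ / K)) + c * A * (em - 1) - c * ((β - α) / K) * em)|
      ≤ Real.exp c * (4 * c * (1 + c) / K) := mul_le_mul hW.2.1 (by rw [← hfin]; exact hrem) (abs_nonneg _) (Real.exp_pos c).le
    _ = 4 * c * (1 + c) * Real.exp c / K := by ring

/-! ## §2 The jumps -/

/-- **THE FORWARD JUMP:** `|f(G+1) − f(G)| ≤ 2(1+c)²e^c` for `G ≤ K` (`c ≤ K`). [ours] -/
theorem pairEigen_f_succ_sub (hσ0 : 0 < σ) (hσ1 : σ < 1) (hα0 : 0 < α) (hα1 : α ≤ 1) (hβ0 : 0 < β) (hβ1 : β ≤ 1) (hp0 : 0 < p) (hp1 : p < 1)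
    (hcbar : cbar = p * α + (1 - p) * β) (hgs : gs = p * α / cbar) (hD0 : D0 = (1 - σ) + σ * α * β / cbar)
    (hγ : γ = σ * (β - α) / D0) (hc : c = σ / D0)
    (hf : ∀ G : ℕ, f G = ((G : ℝ) - gs * K) * Real.exp (γ * (((G : ℝ) - gs * K) / K)))
    (hK : 1 ≤ K) (hcK : c ≤ K) {G : ℕ} (hG : G ≤ K) : |f (G + 1) - f G| ≤ 2 * (1 + c) ^ 2 * Real.exp c := by
  have hK0 : (0 : ℝ) < K := by exact_mod_cast (show 0 < K by omega)
  have hK1 : (1 : ℝ) ≤ K := by exact_mod_cast hK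
  have hGK : (G : ℝ) ≤ K := by exact_mod_cast hG
  have hG0 : (0 : ℝ) ≤ G := Nat.cast_nonneg G
  have hgsb := pairEigen_gs_bounds hα0 hα1 hβ0 hβ1 hp0 hp1 hcbar hgs
  have hcc := pairEigen_c_bounds hσ0 hσ1 hα0 hα1 hβ0 hβ1 hp0 hp1 hcbar hD0 hc
  have hγc := pairEigen_abs_γ_le_c hσ0 hσ1 hα0 hα1 hβ0 hβ1 hp0 hp1 hcbar hD0 hγ hc
  have hW := pairEigen_weight_bounds hK hG hgsb.1.le hgsb.2.le hγc
  have hgsK : gs * K ≤ (K : ℝ) := mul_le_of_le_one_left hK0.le hgsb.2.le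
  have hgsK0 : 0 ≤ gs * (K : ℝ) := mul_nonneg hgsb.1.le hK0.le
  have hy1 : |(G : ℝ) - gs * K + 1| ≤ K + 1 := abs_le.mpr ⟨by linarith, by linarith⟩
  have hsK : |γ / K| ≤ 1 := by
    rw [abs_div, abs_of_pos hK0, div_le_one hK0]
    exact le_trans hγc hcK
  obtain ⟨hr, -, -⟩ := pairEigen_exp_small hsK
  set y : ℝ := (G : ℝ) - gs * K with hy
  set E : ℝ := Real.exp (γ * (y / K)) with hE
  set ep : ℝ := Real.exp (γ / K) with hep
  have hE0 : 0 < E := Real.exp_pos _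
  have e2 : f G = y * E := by rw [hf]
  have e1 : f (G + 1) = (y + 1) * E * ep := by
    rw [hf]
    have h1 : (((G + 1 : ℕ) : ℝ) - gs * K) = y + 1 := by push_cast; rw [hy]; ring
    have h2 : γ * ((((G + 1 : ℕ) : ℝ) - gs * K) / K) = γ * (y / K) + γ / K := by rw [h1]; ring
    rw [h2, h1, Real.exp_add]; ring
  have key : f (G + 1) - f G = E * (1 + γ * (y / K) + γ / K + (y + 1) * (ep - 1 - γ / K)) := by rw [e1, e2]; ring
  rw [key, abs_mul, abs_of_pos hE0]
  have hcore := pairEigen_jump_core hK1 hγc hW.2.2 hy1 hr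
  calc E * |1 + γ * (y / K) + γ / K + (y + 1) * (ep - 1 - γ / K)| ≤ Real.exp c * (2 * (1 + c) ^ 2) :=
        mul_le_mul hW.2.1 hcore (abs_nonneg _) (Real.exp_pos c).le
    _ = 2 * (1 + c) ^ 2 * Real.exp c := by ring

/-- **THE BACKWARD JUMP:** `|f(G−1) − f(G)| ≤ 2(1+c)²e^c` for `1 ≤ G ≤ K` (`c ≤ K`). [ours] -/
theorem pairEigen_f_pred_sub (hσ0 : 0 < σ) (hσ1 : σ < 1) (hα0 : 0 < α) (hα1 : α ≤ 1) (hβ0 : 0 < β) (hβ1 : β ≤ 1) (hp0 : 0 < p) (hp1 : p < 1)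
    (hcbar : cbar = p * α + (1 - p) * β) (hgs : gs = p * α / cbar) (hD0 : D0 = (1 - σ) + σ * α * β / cbar)
    (hγ : γ = σ * (β - α) / D0) (hc : c = σ / D0)
    (hf : ∀ G : ℕ, f G = ((G : ℝ) - gs * K) * Real.exp (γ * (((G : ℝ) - gs * K) / K)))
    (hK : 1 ≤ K) (hcK : c ≤ K) {G : ℕ} (hG1 : 1 ≤ G) (hG : G ≤ K) : |f (G - 1) - f G| ≤ 2 * (1 + c) ^ 2 * Real.exp c := by
  have h1 : G - 1 ≤ K := le_trans (Nat.sub_le G 1) hG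
  have h2 : G - 1 + 1 = G := by omega
  have h := pairEigen_f_succ_sub hσ0 hσ1 hα0 hα1 hβ0 hβ1 hp0 hp1 hcbar hgs hD0 hγ hc hf hK hcK h1
  rw [h2] at h
  rwa [abs_sub_comm]

/-- **THE CORRECTOR IS SMALL AND NON-NEGATIVE:** `0 ≤ κ(G) ≤ ce^c` for `G ≤ K`. [ours] -/
theorem pairEigen_κ_bounds (hσ0 : 0 < σ) (hσ1 : σ < 1) (hα0 : 0 < α) (hα1 : α ≤ 1) (hβ0 : 0 < β) (hβ1 : β ≤ 1) (hp0 : 0 < p) (hp1 : p < 1)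
    (hcbar : cbar = p * α + (1 - p) * β) (hgs : gs = p * α / cbar) (hD0 : D0 = (1 - σ) + σ * α * β / cbar)
    (hγ : γ = σ * (β - α) / D0) (hc : c = σ / D0)
    (hκ : ∀ G : ℕ, κ G = c * ((α * ((K : ℝ) - G) + β * G) / K) * Real.exp (γ * (((G : ℝ) - gs * K) / K)))
    (hK : 1 ≤ K) {G : ℕ} (hG : G ≤ K) : 0 ≤ κ G ∧ κ G ≤ c * Real.exp c := by
  have hgsb := pairEigen_gs_bounds hα0 hα1 hβ0 hβ1 hp0 hp1 hcbar hgs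
  have hcc := pairEigen_c_bounds hσ0 hσ1 hα0 hα1 hβ0 hβ1 hp0 hp1 hcbar hD0 hc
  have hγc := pairEigen_abs_γ_le_c hσ0 hσ1 hα0 hα1 hβ0 hβ1 hp0 hp1 hcbar hD0 hγ hc
  have hA := pairEigen_A_bounds hα0 hα1 hβ0 hβ1 hK hG
  have hW := pairEigen_weight_bounds hK hG hgsb.1.le hgsb.2.le hγc
  rw [hκ]
  refine ⟨by have := hcc.1; have := hA.1; positivity, ?_⟩
  calc c * ((α * ((K : ℝ) - G) + β * G) / K) * Real.exp (γ * (((G : ℝ) - gs * K) / K)) ≤ c * 1 * Real.exp c :=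
        mul_le_mul (mul_le_mul_of_nonneg_left hA.2 hcc.1.le) hW.2.1 (Real.exp_pos _).le (by have := hcc.1; positivity)
    _ = c * Real.exp c := by ring

/-! ## §3 The two starts -/

/-- **THE CROWDED START** (all `K+1` particles carry `u`: `G = K`, hub `= u`): `f(K) + κ(K) ≥ K(1−g⋆)e^{−c}`. [ours] -/
theorem pairEigen_start_crowded (hσ0 : 0 < σ) (hσ1 : σ < 1) (hα0 : 0 < α) (hα1 : α ≤ 1) (hβ0 : 0 < β) (hβ1 : β ≤ 1) (hp0 : 0 < p) (hp1 : p < 1)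
    (hcbar : cbar = p * α + (1 - p) * β) (hgs : gs = p * α / cbar) (hD0 : D0 = (1 - σ) + σ * α * β / cbar)
    (hγ : γ = σ * (β - α) / D0) (hc : c = σ / D0)
    (hf : ∀ G : ℕ, f G = ((G : ℝ) - gs * K) * Real.exp (γ * (((G : ℝ) - gs * K) / K)))
    (hκ : ∀ G : ℕ, κ G = c * ((α * ((K : ℝ) - G) + β * G) / K) * Real.exp (γ * (((G : ℝ) - gs * K) / K)))
    (hK : 1 ≤ K) : (K : ℝ) * (1 - gs) * Real.exp (-c) ≤ f K + κ K := by
  have hgsb := pairEigen_gs_bounds hα0 hα1 hβ0 hβ1 hp0 hp1 hcbar hgs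
  have hγc := pairEigen_abs_γ_le_c hσ0 hσ1 hα0 hα1 hβ0 hβ1 hp0 hp1 hcbar hD0 hγ hc
  have hκb := pairEigen_κ_bounds hσ0 hσ1 hα0 hα1 hβ0 hβ1 hp0 hp1 hcbar hgs hD0 hγ hc hκ hK le_rfl
  have hW := pairEigen_weight_bounds hK le_rfl hgsb.1.le hgsb.2.le hγc (G := K)
  have hK0 : (0 : ℝ) ≤ K := Nat.cast_nonneg K
  have e : f K = (K : ℝ) * (1 - gs) * Real.exp (γ * (((K : ℝ) - gs * K) / K)) := by rw [hf]; ring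
  have h1 : (K : ℝ) * (1 - gs) * Real.exp (-c) ≤ f K := by
    rw [e]; exact mul_le_mul_of_nonneg_left hW.1 (by nlinarith [hgsb.2])
  linarith [hκb.1]

/-- **THE `u`-FREE START** (no particle carries `u`: `G = 0`, hub `≠ u`): `−f(0) ≥ Kg⋆e^{−c}`. [ours] -/
theorem pairEigen_start_free (hα0 : 0 < α) (hα1 : α ≤ 1) (hβ0 : 0 < β) (hβ1 : β ≤ 1) (hp0 : 0 < p) (hp1 : p < 1)
    (hcbar : cbar = p * α + (1 - p) * β) (hgs : gs = p * α / cbar) (hγc : |γ| ≤ c)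
    (hf : ∀ G : ℕ, f G = ((G : ℝ) - gs * K) * Real.exp (γ * (((G : ℝ) - gs * K) / K)))
    (hK : 1 ≤ K) : (K : ℝ) * gs * Real.exp (-c) ≤ -f 0 := by
  have hgsb := pairEigen_gs_bounds hα0 hα1 hβ0 hβ1 hp0 hp1 hcbar hgs
  have hW := pairEigen_weight_bounds hK (Nat.zero_le K) hgsb.1.le hgsb.2.le hγc (G := 0)
  have hK0 : (0 : ℝ) ≤ K := Nat.cast_nonneg K
  have e : -f 0 = (K : ℝ) * gs * Real.exp (γ * ((((0 : ℕ) : ℝ) - gs * K) / K)) := by rw [hf]; push_cast; ring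
  rw [e]
  exact mul_le_mul_of_nonneg_left hW.1 (by nlinarith [hgsb.1])

end PairEigenDefect

end Summit.Ventures.LatticeQCDFlow.Scaling

end
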